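import Summits.NavierStokesRegularity.FluidComputer.BlockRegulation
import Summits.NavierStokesRegularity.FluidComputer.BlockBlowup

/-!
# Fourier-block instance — §10 THE REGULATING GATE: the CIRCUIT+CLOCK half inhabited, honestly

HONEST FRAMING. Low prior, high value-of-information experiment on Tao's machine paradigm; NOT a
claim that NS blows up. Nothing in this file is evidence about Navier–Stokes: it exhibits a
DESIGN-LEVEL object (a planar gate) and splits the residual structure `BlockStatics.Dynamics` into
the half this lane can build and the half it cannot.

1. `CircuitClock P` / `IdeaBound 𝒟 P C`: `Dynamics 𝒟 P` is literally a circuit+clock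
   (`Φ, τc, δsh, dat, unit, clock`) together with the two IDEA-BOUND claims (`shadow`, `leak`)
   about every `H¹⁰_df`-mild Navier–Stokes trajectory relative to that circuit
   (`Dynamics.ofHalves`, `Dynamics.circuitClock`, `Dynamics.ideaBound`).
2. `regGate η r`: the energy-bookkept REGULATING GATE on the observable plane — a quarter rotation
   in the `(a, √η b)` energy circle over rescaled time `[0, 1]` (complete transfer at constant
   two-block energy), then a bleed of the fraction `≤ r` of the pair energy over `[1, 2]`
   (the surplus parked outside both blocks). It is `0`-passive and `(1 − r)`-delivering
   (`regGate_passive`, `regGate_delivers`), and `regGate η r 0 = id`.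
3. `Params.reg` (`[aLo, aHi] = [3/2, 2]`, `c0 = 3/20`, `δ = 1/20`, `σsp = 1/4`, thresholds as in
   `Params.std`; budgets are theorems for `η ≥ 1/2`) and `regGate_dat`: with `r = 3/10`,
   `δsh = 1/50`, `τc = 2` the gate inhabits `Dat` for every `η ∈ [4/5, 9/10]` — so the CIRCUIT+CLOCK
   half `regCircuitClock` EXISTS at viscosity-admissible efficiencies (`alphaEff ≥ 2`), and the
   passive bound of `BlockRegulation` (`η (aLo + δsh)² ≤ (aLo − δ)²`, here `η ≤ 0.910…`) is sharp to
   1% while the withholding law is met with `r = 0.3` against its floor `≈ 0.14`.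
4. `ns_blowup_of_regIdeaBound`: for these windows the residue of the whole lane is EXACTLY
   `IdeaBound 𝒟 Params.reg regCircuitClock` — two fully explicit statements about Navier–Stokes
   mild solutions with no free design parameter left (besides the wavelet datum `𝒟` and the spec
   `S`). They assert that true NS, started from `a √E_n ψ_n + (junk ≤ ½ √E_n)`, follows an
   amplitude-independent quarter rotation of its two block amplitudes within `T_n`, parks 30% of
   the pair energy outside both blocks on cue, and keeps its weighted junk below `√E_n` meanwhile.
   This lane records them as IDEA-BOUND and PRESUMABLY FALSE for the two-wavelet design (no
   mechanism is proposed that would make a pair of Fourier shells behave so); the point of item 4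
   is that the residue is now a closed formula, not that it is plausible.

SUPERSEDED IN PART by `BlockOpenWindow` (§11): the withholding `r = 3/10` and the amplitude-dependent
firing instant of `regGate_dat` are forced only by the BOUNDED upper window `aHi = 2` of
`Params.reg`; that window is inessential to the architecture, and with the half-open windows of §11
the CONSERVATIVE quarter turn `regGate η 0` (this file's gate with `r = 0`, firing at `σ = 1` from
every input) inhabits `dat` for every `η ∈ [1/2, 9/10]`. The theorems of this file stand as stated
(they are about the bounded windows); the "regulation" reading does not transfer to open windows.
-/

noncomputable section

open MeasureTheory Set Filter Topology Metric
open scoped ENNReal NNReal SchwartzMap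

namespace Summit.NavierStokesRegularity.FluidComputer

open Literature.Analysis.FluidPDE Literature.Analysis.FluidPDE.Tao2016
open Literature.Analysis.FluidPDE.FluidComputer

namespace BlockDesign

/-! ## The two halves of the residue -/

section Halves

variable (𝒟 : CascadeWaveletData 1 1) {S : CascadeSpecs} (P : Params S)

/-- The CIRCUIT+CLOCK half of `Dynamics`: a gate `Φ` on the observable plane with cycle time `τc`,
margin `δsh` and the delayed-abrupt-transition certificate `Dat`, plus a clock fitting one cycle
into `Tmax n`. Design-level; inhabited below for `Params.reg`. [folklore] -/
structure CircuitClock where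
  /-- the gate, in rescaled time -/
  Φ : ℝ → ℝ × ℝ → ℝ × ℝ
  /-- rescaled cycle time -/
  τc : ℝ
  τc_nonneg : 0 ≤ τc
  /-- shadowing margin -/
  δsh : ℝ
  δsh_nonneg : 0 ≤ δsh
  /-- delayed abrupt transition with margin -/
  dat : Dat P Φ τc δsh
  /-- physical time per unit rescaled time at generation `n` -/
  unit : ℕ → ℝ
  unit_pos : ∀ n, 0 < unit n
  clock : ∀ n, unit n * τc ≤ S.Tmax n

/-- The IDEA-BOUND half of `Dynamics` relative to a circuit+clock `C`: every `H¹⁰_df`-mild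
Navier–Stokes trajectory read in `Ain` with loaded junk shadows `C.Φ` within `C.δsh` for one cycle
(`shadow`) while its weighted junk stays below the running threshold (`leak`). Presumably FALSE
for the two-wavelet design; nothing here asserts it. [folklore] -/
structure IdeaBound (C : CircuitClock P) : Prop where
  /-- shadowing -/
  shadow : ∀ (n : ℕ) (a : L2C) (S' : ℝ) (u : ℝ → L2C), IsMildSolutionFor eulerForm a (Ico 0 S') u →
    ∀ t : ℝ, 0 ≤ t → read 𝒟 S n (u t) ∈ Ain P →
      junk 𝒟 P n (u t) ≤ ENNReal.ofReal (P.jin * Real.sqrt (S.Emin n)) →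
      ∀ σ : ℝ, 0 ≤ σ → σ ≤ C.τc → t + C.unit n * σ < S' →
        dist (read 𝒟 S n (u (t + C.unit n * σ))) (C.Φ σ (read 𝒟 S n (u t))) ≤ C.δsh
  /-- leakage -/
  leak : ∀ (n : ℕ) (a : L2C) (S' : ℝ) (u : ℝ → L2C), IsMildSolutionFor eulerForm a (Ico 0 S') u →
    ∀ t : ℝ, 0 ≤ t → read 𝒟 S n (u t) ∈ Ain P →
      junk 𝒟 P n (u t) ≤ ENNReal.ofReal (P.jin * Real.sqrt (S.Emin n)) →
      ∀ σ : ℝ, 0 ≤ σ → σ ≤ C.τc → t + C.unit n * σ < S' →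
        junk 𝒟 P n (u (t + C.unit n * σ)) ≤ ENNReal.ofReal (P.jrun * Real.sqrt (S.Emin n))

variable {𝒟 P}

/-- Gluing the two halves gives a residue. [folklore] -/
def Dynamics.ofHalves (C : CircuitClock P) (H : IdeaBound 𝒟 P C) : Dynamics 𝒟 P where
  Φ := C.Φ
  τc := C.τc
  τc_nonneg := C.τc_nonneg
  δsh := C.δsh
  δsh_nonneg := C.δsh_nonneg
  dat := C.dat
  unit := C.unit
  unit_pos := C.unit_pos
  clock := C.clock
  shadow := H.shadow
  leak := H.leak

/-- The circuit+clock half of a residue. [folklore] -/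
def Dynamics.circuitClock (Dy : Dynamics 𝒟 P) : CircuitClock P where
  Φ := Dy.Φ
  τc := Dy.τc
  τc_nonneg := Dy.τc_nonneg
  δsh := Dy.δsh
  δsh_nonneg := Dy.δsh_nonneg
  dat := Dy.dat
  unit := Dy.unit
  unit_pos := Dy.unit_pos
  clock := Dy.clock

/-- The idea-bound half of a residue. [folklore] -/
theorem Dynamics.ideaBound (Dy : Dynamics 𝒟 P) : IdeaBound 𝒟 P Dy.circuitClock :=
  ⟨Dy.shadow, Dy.leak⟩

end Halves

/-! ## The regulating gate -/

section Gate

/-- The REGULATING GATE with efficiency `η` and withholding `r`, in rescaled time `σ`: for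
`σ ∈ [0, 1)` the quarter rotation of `(a, √η b)` by the angle `(π/2) σ` (two-block energy
conserved exactly; `σ ≤ 0` is the identity); for `σ ≥ 1` the rotated state `(−√η b, a/√η)`
scaled by `√(1 − r min(σ − 1, 1))` (the fraction `≤ r` of the pair energy bled out). [folklore] -/
def regGate (η r : ℝ) (σ : ℝ) (p : ℝ × ℝ) : ℝ × ℝ :=
  if σ < 1 then
    (p.1 * Real.cos (Real.pi / 2 * max σ 0) - Real.sqrt η * p.2 * Real.sin (Real.pi / 2 * max σ 0),
      (p.1 * Real.sin (Real.pi / 2 * max σ 0) + Real.sqrt η * p.2 * Real.cos (Real.pi / 2 * max σ 0)) /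
        Real.sqrt η)
  else
    (-(Real.sqrt η * p.2 * Real.sqrt (1 - r * min (σ - 1) 1)),
      p.1 * Real.sqrt (1 - r * min (σ - 1) 1) / Real.sqrt η)

/-- At `σ = 0` the gate is the identity. [folklore] -/
theorem regGate_zero {η : ℝ} (hη : 0 < η) (r : ℝ) (p : ℝ × ℝ) : regGate η r 0 p = p := by
  have hne : Real.sqrt η ≠ 0 := Real.sqrt_ne_zero'.2 hη
  simp only [regGate, if_pos one_pos, max_self, mul_zero, Real.cos_zero, Real.sin_zero, mul_one,
    mul_zero, sub_zero, zero_add]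
  rw [mul_div_cancel_left₀ _ hne]

/-- Rotation phase: the two-block energy is conserved. [folklore] -/
theorem pairEnergy_regGate_of_lt_one {η : ℝ} (hη : 0 < η) (r : ℝ) {σ : ℝ} (hσ : σ < 1)
    (p : ℝ × ℝ) : pairEnergy η (regGate η r σ p) = pairEnergy η p := by
  have he : Real.sqrt η ^ 2 = η := Real.sq_sqrt hη.le
  have hcs := Real.sin_sq_add_cos_sq (Real.pi / 2 * max σ 0)
  simp only [regGate, if_pos hσ, pairEnergy]
  rw [div_pow, he, ← mul_div_assoc, mul_div_cancel_left₀ _ hη.ne']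
  linear_combination (p.1 ^ 2 + Real.sqrt η ^ 2 * p.2 ^ 2) * hcs + p.2 ^ 2 * he

/-- Bleed phase: the two-block energy is the fraction `1 − r min(σ − 1, 1) ∈ [1 − r, 1]` of the
initial one. [folklore] -/
theorem pairEnergy_regGate_of_one_le {η r : ℝ} (hη : 0 < η) (hr1 : r ≤ 1) {σ : ℝ}
    (hσ : 1 ≤ σ) (p : ℝ × ℝ) :
    pairEnergy η (regGate η r σ p) = (1 - r * min (σ - 1) 1) * pairEnergy η p := by
  have hm0 : 0 ≤ min (σ - 1) 1 := le_min (by linarith) zero_le_one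
  have hm1 : min (σ - 1) 1 ≤ 1 := min_le_right _ _
  have hd : 0 ≤ 1 - r * min (σ - 1) 1 := by nlinarith [mul_le_mul hr1 hm1 hm0 zero_le_one]
  have he : Real.sqrt η ^ 2 = η := Real.sq_sqrt hη.le
  have hdd : Real.sqrt (1 - r * min (σ - 1) 1) ^ 2 = 1 - r * min (σ - 1) 1 := Real.sq_sqrt hd
  simp only [regGate, if_neg (not_lt.2 hσ), pairEnergy]
  rw [neg_sq, div_pow, he, ← mul_div_assoc, mul_div_cancel_left₀ _ hη.ne']
  linear_combination (p.1 ^ 2 + Real.sqrt η ^ 2 * p.2 ^ 2) * hdd +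
    (1 - r * min (σ - 1) 1) * p.2 ^ 2 * he

variable {S : CascadeSpecs} (P : Params S)

/-- The regulating gate is `0`-passive (for any cycle time). [folklore] -/
theorem regGate_passive {r : ℝ} (hr0 : 0 ≤ r) (hr1 : r ≤ 1) (τc : ℝ) :
    Passive P (regGate S.eta r) τc 0 := by
  intro p _ σ _ _
  rcases lt_or_ge σ 1 with hσ | hσ
  · rw [pairEnergy_regGate_of_lt_one S.eta_pos r hσ p, add_zero]
  · rw [pairEnergy_regGate_of_one_le S.eta_pos hr1 hσ p, add_zero]
    have he0 := pairEnergy_nonneg S.eta_pos.le p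
    have hm0 : 0 ≤ min (σ - 1) 1 := le_min (by linarith) zero_le_one
    nlinarith [mul_nonneg (mul_nonneg hr0 hm0) he0]

/-- The regulating gate is `(1 − r)`-delivering (for any cycle time). [folklore] -/
theorem regGate_delivers {r : ℝ} (hr0 : 0 ≤ r) (hr1 : r ≤ 1) (τc : ℝ) :
    Delivers P (regGate S.eta r) τc r := by
  intro p _ σ _ _
  have he0 := pairEnergy_nonneg S.eta_pos.le p
  rcases lt_or_ge σ 1 with hσ | hσ
  · rw [pairEnergy_regGate_of_lt_one S.eta_pos r hσ p]
    nlinarith [mul_nonneg hr0 he0]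
  · rw [pairEnergy_regGate_of_one_le S.eta_pos hr1 hσ p]
    have hm1 : min (σ - 1) 1 ≤ 1 := min_le_right _ _
    nlinarith [mul_nonneg (mul_nonneg hr0 (sub_nonneg.2 hm1)) he0]

/-- Coordinates of `Ain`: `aLo − δ < a < aHi + δ` and `|b| < c0 + δ`. [folklore] -/
theorem Ain_bounds {p : ℝ × ℝ} (hp : p ∈ Ain P) :
    P.aLo - P.δ < p.1 ∧ p.1 < P.aHi + P.δ ∧ |p.2| < P.c0 + P.δ := by
  obtain ⟨q, hq, hd⟩ := hp
  have hq' : (P.aLo ≤ q.1 ∧ q.1 ≤ P.aHi) ∧ (-P.c0 ≤ q.2 ∧ q.2 ≤ P.c0) := by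
    simpa only [Acore, Set.mem_prod, Set.mem_Icc] using hq
  rw [Prod.dist_eq, Real.dist_eq, Real.dist_eq] at hd
  have h1 := abs_lt.1 (lt_of_le_of_lt (le_max_left _ _) hd)
  have h2 := abs_lt.1 (lt_of_le_of_lt (le_max_right _ _) hd)
  exact ⟨by linarith [h1.1], by linarith [h1.2], abs_lt.2 ⟨by linarith [h2.1], by linarith [h2.2]⟩⟩

end Gate

/-! ## Re-tuned windows and the inhabited circuit+clock -/

section Reg

variable (S : CascadeSpecs)

/-- **Regulation parameters**: `Params.std` with a thin core `δ = 1/20` and output tolerance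
`c0 = 3/20` (so `c0 + δ + 1/50 < σsp = 1/4`); budgets: `1 ≤ (3/20) η 4^{10}` and
`(2^{-10} + (3/4)^{10}) + (3/4)^{10}/4 ≈ 0.0714 ≤ √η/5` for `η ≥ 1/2`. [folklore] -/
def Params.reg (hS : S.lam0 = 1) (hη : 1 / 2 ≤ S.eta) : Params S where
  s := 10
  μ := 1
  aLo := 3 / 2
  aHi := 2
  c0 := 3 / 20
  δ := 1 / 20
  σsp := 1 / 4
  jcore := 1 / 5
  jin := 1 / 2
  jrun := 1
  lam0_eq := hS
  s_nonneg := by norm_num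
  μ_nonneg := by norm_num
  μ_le_one := le_rfl
  δ_pos := by norm_num
  one_le := by norm_num
  aLo_le_aHi := by norm_num
  c0_nonneg := by norm_num
  jcore_nonneg := by norm_num
  jcore_lt_jin := by norm_num
  jin_le_jrun := by norm_num
  next_output := by rw [four_rpow_ten]; linarith
  erasure := by
    have hη' : (1 / 2 : ℝ) < Real.sqrt S.eta := by
      rw [Real.lt_sqrt (by norm_num)]; linarith
    rw [half_rpow_ten, threeQuarter_rpow_ten]
    linarith

/-- **The regulating gate inhabits `Dat` for `Params.reg`** with `r = 3/10`, `τc = 2`,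
`δsh = 1/50`, for every efficiency `η ∈ [4/5, 9/10]`: from input `(a, b)` fire at
`σ = 1 + (1 − d)/r`, `d = min 1 (η (aHi − δsh)²/a²)`, landing at `(−√η b √d, min (a/√η) (aHi − δsh))`.
[folklore] -/
theorem regGate_dat (hS : S.lam0 = 1) (hη : 1 / 2 ≤ S.eta) (hη1 : 4 / 5 ≤ S.eta)
    (hη2 : S.eta ≤ 9 / 10) : Dat (Params.reg S hS hη) (regGate S.eta (3 / 10)) 2 (1 / 50) := by
  intro p hp
  obtain ⟨ha1, ha2, hb⟩ := Ain_bounds (Params.reg S hS hη) hp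
  replace ha1 : (3 : ℝ) / 2 - 1 / 20 < p.1 := ha1
  replace ha2 : p.1 < 2 + 1 / 20 := ha2
  replace hb : |p.2| < 3 / 20 + 1 / 20 := hb
  have hη0 : 0 < S.eta := S.eta_pos
  obtain ⟨e, he_def⟩ : ∃ e : ℝ, e = Real.sqrt S.eta := ⟨_, rfl⟩
  have he2 : e ^ 2 = S.eta := by rw [he_def]; exact Real.sq_sqrt hη0.le
  have he0 : 0 < e := by rw [he_def]; exact Real.sqrt_pos.2 hη0
  have he1 : e ≤ 1 := by rw [he_def, ← Real.sqrt_one]; exact Real.sqrt_le_sqrt S.eta_le_one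
  have ha0 : 0 < p.1 := by linarith
  obtain ⟨D, hD_def⟩ : ∃ D : ℝ, D = S.eta * (2 - 1 / 50) ^ 2 / p.1 ^ 2 := ⟨_, rfl⟩
  have hD0 : 0 < D := by rw [hD_def]; positivity
  obtain ⟨d, hd_def⟩ : ∃ d : ℝ, d = min 1 D := ⟨_, rfl⟩
  have hd1 : d ≤ 1 := by rw [hd_def]; exact min_le_left _ _
  have hd0 : 0 < d := by rw [hd_def]; exact lt_min one_pos hD0
  have hD7 : 7 / 10 ≤ D := by
    rw [hD_def, le_div_iff₀ (pow_pos ha0 2)]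
    have : p.1 ^ 2 < (2 + 1 / 20) ^ 2 := by nlinarith
    nlinarith
  have hd7 : 7 / 10 ≤ d := by rw [hd_def]; exact le_min (by norm_num) hD7
  have hsd0 : 0 ≤ Real.sqrt d := Real.sqrt_nonneg _
  have hsd1 : Real.sqrt d ≤ 1 := by rw [← Real.sqrt_one]; exact Real.sqrt_le_sqrt hd1
  -- the firing instant
  obtain ⟨σ, hσ_def⟩ : ∃ σ : ℝ, σ = 1 + (1 - d) / (3 / 10) := ⟨_, rfl⟩
  have hm_le : (1 - d) / (3 / 10) ≤ 1 := by rw [div_le_one (by norm_num)]; linarith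
  have hm_nn : 0 ≤ (1 - d) / (3 / 10) := div_nonneg (by linarith) (by norm_num)
  have hσ1 : ¬ σ < 1 := not_lt.2 (by linarith)
  have hm : min (σ - 1) 1 = (1 - d) / (3 / 10) := by
    rw [hσ_def, add_sub_cancel_left]; exact min_eq_left hm_le
  have hdd : 1 - 3 / 10 * ((1 - d) / (3 / 10)) = d := by ring
  have hgate : regGate S.eta (3 / 10) σ p = (-(e * p.2 * Real.sqrt d), p.1 * Real.sqrt d / e) := by
    simp only [regGate, if_neg hσ1]
    rw [hm, hdd, he_def]
  refine ⟨σ, by linarith, by linarith, ?_⟩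
  -- the landing point and its margins
  have hx : |e * p.2 * Real.sqrt d| ≤ 1 / 5 := by
    rw [abs_mul, abs_mul, abs_of_pos he0, abs_of_nonneg hsd0]
    calc e * |p.2| * Real.sqrt d ≤ |p.2| * 1 :=
          mul_le_mul (mul_le_of_le_one_left (abs_nonneg _) he1) hsd1 hsd0 (abs_nonneg _)
      _ ≤ 1 / 5 := by linarith
  have hy : 3 / 2 + 1 / 50 ≤ p.1 * Real.sqrt d / e ∧ p.1 * Real.sqrt d / e ≤ 2 - 1 / 50 := by
    rcases le_total 1 D with hcase | hcase
    · -- d = 1: land at a/√η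
      have hd_eq : d = 1 := by rw [hd_def]; exact min_eq_left hcase
      rw [hd_eq, Real.sqrt_one, mul_one]
      have hc' : p.1 ^ 2 ≤ S.eta * (2 - 1 / 50) ^ 2 := by
        rwa [hD_def, le_div_iff₀ (pow_pos ha0 2), one_mul] at hcase
      constructor
      · rw [le_div_iff₀ he0]; nlinarith
      · rw [div_le_iff₀ he0]
        by_contra hlt
        have hlt' : (2 - 1 / 50) * e < p.1 := not_le.1 hlt
        have h2 : ((2 - 1 / 50) * e) ^ 2 < p.1 ^ 2 :=
          pow_lt_pow_left₀ hlt' (by positivity) two_ne_zero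
        have h3 : (2 - 1 / 50) ^ 2 * e ^ 2 < p.1 ^ 2 := by rw [← mul_pow]; exact h2
        rw [he2] at h3
        linarith
    · -- d = D ≤ 1: land exactly at aHi − δsh
      have hd_eq : d = D := by rw [hd_def]; exact min_eq_right hcase
      have hsD : Real.sqrt D = e * (2 - 1 / 50) / p.1 := by
        rw [show D = (e * (2 - 1 / 50) / p.1) ^ 2 by rw [div_pow, mul_pow, he2, hD_def]]
        exact Real.sqrt_sq (by positivity)
      rw [hd_eq, hsD]
      have : p.1 * (e * (2 - 1 / 50) / p.1) / e = 2 - 1 / 50 := by field_simp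
      rw [this]
      constructor <;> norm_num
  intro q hq
  rw [hgate, Metric.mem_closedBall, Prod.dist_eq, Real.dist_eq, Real.dist_eq] at hq
  have hq1 := abs_le.1 (le_trans (le_max_left _ _) hq)
  have hq2 := abs_le.1 (le_trans (le_max_right _ _) hq)
  have hx' := abs_le.1 hx
  show (-(1 / 4 : ℝ) ≤ q.1 ∧ q.1 ≤ 1 / 4) ∧ ((3 : ℝ) / 2 ≤ q.2 ∧ q.2 ≤ 2)
  refine ⟨⟨?_, ?_⟩, ?_, ?_⟩
  · simp only [sub_neg_eq_add] at hq1; linarith [hq1.1, hx'.2]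
  · simp only [sub_neg_eq_add] at hq1; linarith [hq1.2, hx'.1]
  · linarith [hq2.1, hy.1]
  · linarith [hq2.2, hy.2]

/-- **The CIRCUIT+CLOCK half inhabited** for `Params.reg`, `η ∈ [4/5, 9/10]`: the regulating gate
with `r = 3/10`, `τc = 2`, `δsh = 1/50`, and the clock `unit n = Tmax n / 2`. [folklore] -/
def regCircuitClock (hS : S.lam0 = 1) (hη : 1 / 2 ≤ S.eta) (hη1 : 4 / 5 ≤ S.eta)
    (hη2 : S.eta ≤ 9 / 10) : CircuitClock (Params.reg S hS hη) where
  Φ := regGate S.eta (3 / 10)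
  τc := 2
  τc_nonneg := by norm_num
  δsh := 1 / 50
  δsh_nonneg := by norm_num
  dat := regGate_dat S hS hη hη1 hη2
  unit n := S.Tmax n / 2
  unit_pos n := half_pos (S.Tmax_pos n)
  clock n := by rw [div_mul_cancel₀ (S.Tmax n) two_ne_zero]

/-- The regulating circuit is `0`-passive and `7/10`-delivering, so it meets the hypotheses of the
withholding law of `BlockRegulation` (with `r = 3/10`): the law is not vacuous. [folklore] -/
theorem regCircuitClock_passive_delivers (hS : S.lam0 = 1) (hη : 1 / 2 ≤ S.eta)
    (hη1 : 4 / 5 ≤ S.eta) (hη2 : S.eta ≤ 9 / 10) :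
    Passive (Params.reg S hS hη) (regCircuitClock S hS hη hη1 hη2).Φ
        (regCircuitClock S hS hη hη1 hη2).τc 0 ∧
      Delivers (Params.reg S hS hη) (regCircuitClock S hS hη hη1 hη2).Φ
        (regCircuitClock S hS hη hη1 hη2).τc (3 / 10) :=
  ⟨regGate_passive _ (by norm_num) (by norm_num) _, regGate_delivers _ (by norm_num) (by norm_num) _⟩

/-- At these efficiencies the spec is viscosity-admissible: `2 ≤ alphaEff` (indeed `> 2`).
[folklore] -/
theorem two_le_alphaEff_of_reg (hη1 : 4 / 5 ≤ S.eta) : 2 ≤ S.alphaEff :=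
  S.two_le_alphaEff_iff.2 (by linarith)

variable {S}

/-- **The residue as a closed formula.** For `Params.reg` at `η ∈ [4/5, 9/10]`, `α > 0`: the two
IDEA-BOUND claims about Navier–Stokes relative to the explicit regulating circuit refute Clay (A).
HONEST FRAMING: an implication from a `Prop` this lane presumes FALSE; NOT a claim that NS blows
up; recorded so that the residue has no free design parameter left. -/
theorem ns_blowup_of_regIdeaBound {𝒟 : CascadeWaveletData 1 1} (hS : S.lam0 = 1)
    (hη : 1 / 2 ≤ S.eta) (hη1 : 4 / 5 ≤ S.eta) (hη2 : S.eta ≤ 9 / 10) (hα : 0 < S.alpha)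
    (H : IdeaBound 𝒟 (Params.reg S hS hη) (regCircuitClock S hS hη hη1 hη2)) :
    ¬ NavierStokesRegularity :=
  ns_blowup_of_blockDynamics (Dynamics.ofHalves _ H) hα (by linarith)

end Reg

end BlockDesign

end Summit.NavierStokesRegularity.FluidComputer

end
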